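import Literature.MathematicalPhysics.QuantumManyBody.PeriodizedPotentialNearestImage
import Literature.MathematicalPhysics.QuantumManyBody.PeriodicBoseGasFourier
import Mathlib.Analysis.InnerProductSpace.Projection.Reflection
import Mathlib.Analysis.SpecialFunctions.Trigonometric.Bounds
import Mathlib.Analysis.Calculus.FDeriv.Symmetric
import HarnessLib

/-!
# The Hessian of the periodised pair potential along a density wave and Puff's pair weight

Topic `Literature/MathematicalPhysics/QuantumManyBody`; companion of
`PeriodizedPotentialNearestImage.lean` (for a profile `v` of range `R₀` and `2R₀ < L` the lattice
sum `v^per` is locally a single image `x ↦ v(|x - Ln₀|)`). For the `C²` pair function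
`ṽ(x) = v(|x|)` on `ℝ³` and a wave vector `k = 2πm/L` of the torus we prove the pointwise
estimate behind the potential term of Puff's cubic energy-weighted moment
[Puff1965; Stringari1995, §2.3]: with the **Puff pair weight** `W(r) = r² ‖D²ṽ(r e₀)‖`,

  `|e_m(y) - 1|² · |(k·∇)² v^per(y)| ≤ ‖k‖⁴ · W^per(y)`      (`y ∈ ℝ³`),

where `e_m(y) = e^{ik·y}` (`cellWave`), `(k·∇)² v^per(y) = D²v^per(y)(k,k)` is written as an
iterated directional derivative, and `W^per` is the periodisation of `W` (read through
`periodizedPotential`). Ingredients (all proved here):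

* `norm_iteratedFDeriv_radial_eq` — rotation invariance `‖Dⁿṽ(x)‖ = ‖Dⁿṽ(|x| e₀)‖` of the
  derivative norms of a radial function (a Householder reflection maps `|x|e₀` to `x`,
  `LinearIsometryEquiv.norm_iteratedFDeriv_comp_right`);
* `abs_fderiv_fderiv_apply_le` — `|D²g(z)(k,k)| ≤ ‖D²g(z)‖ ‖k‖²`;
* `iteratedFDeriv_radial_eq_zero_of_lt`, `puffWeight_eq_zero_of_lt`, `measurable_puffWeight` —
  the weight profile vanishes beyond the range and is measurable;
* `exists_fderiv_fderiv_periodizedPotential_eq` — at every point the Hessian of `v^per` is the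
  Hessian of `ṽ` at the nearest image;
* `norm_cellWave_sub_one_sq_le` — `|e_m(y) - 1|² = 2 - 2cos(k·y) ≤ ‖k‖²‖y‖²`;
* `phase_sq_mul_hessian_le_puffWeight` — the displayed estimate.

## References
* [Puff1965] R. D. Puff, *Application of sum rules to the low-temperature interacting boson
  system*, Phys. Rev. 137 (1965) A406 (the cubic moment and its potential term).
* [Stringari1995] S. Stringari, *Sum rules and Bose–Einstein condensation*, in: Bose–Einstein
  Condensation (Griffin, Snoke, Stringari eds.), CUP 1995, §2.3 (20)–(23).
* [LSSY2005] Lieb–Seiringer–Solovej–Yngvason, Ch. 2 (nearest-image convention, `R₀ < L/2`).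
-/

noncomputable section

open Filter Metric Topology
open scoped ENNReal NNReal ComplexConjugate

namespace Literature.MathematicalPhysics.QuantumManyBody.BoseGas

/-! ### Rotation invariance and the directional Hessian -/

section Radial

/-- **Rotation invariance of the derivative norms of a radial function**: for
`ṽ(y) = f(|y|)` on `ℝ³`, `‖Dⁿṽ(x)‖ = ‖Dⁿṽ(|x| e₀)‖` (compose with the reflection mapping
`|x| e₀` to `x`, an isometry fixing `ṽ`). [folklore] -/
theorem norm_iteratedFDeriv_radial_eq (f : ℝ → ℝ) (n : ℕ) (x : Space) :
    ‖iteratedFDeriv ℝ n (fun y : Space => f ‖y‖) x‖ =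
      ‖iteratedFDeriv ℝ n (fun y : Space => f ‖y‖)
        (‖x‖ • EuclideanSpace.single (0 : Fin 3) (1 : ℝ))‖ := by
  set e₀ : Space := EuclideanSpace.single (0 : Fin 3) (1 : ℝ) with he₀
  have he : ‖(‖x‖ • e₀ : Space)‖ = ‖x‖ := by
    rw [norm_smul, norm_norm, he₀]
    simp
  set R : Space ≃ₗᵢ[ℝ] Space := Submodule.reflection (ℝ ∙ ((‖x‖ • e₀ : Space) - x))ᗮ with hR
  have hRx : R (‖x‖ • e₀) = x := Submodule.reflection_sub he
  have hcomp : (fun y : Space => f ‖y‖) ∘ R = fun y : Space => f ‖y‖ := by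
    funext y
    simp only [Function.comp_apply, LinearIsometryEquiv.norm_map]
  have h := R.norm_iteratedFDeriv_comp_right (fun y : Space => f ‖y‖) (‖x‖ • e₀) n
  rw [hcomp, hRx] at h
  exact h.symm

/-- `|D²g(z)(k,k)| ≤ ‖D²g(z)‖ ‖k‖²` for a `C²` function, with `D²g(z)(k,k)` written as the
iterated directional derivative `∂_k(∂_k g)(z)`. [folklore] -/
theorem abs_fderiv_fderiv_apply_le {g : Space → ℝ} (hg : ContDiff ℝ 2 g) (z k : Space) :
    |fderiv ℝ (fun y => fderiv ℝ g y k) z k| ≤ ‖iteratedFDeriv ℝ 2 g z‖ * ‖k‖ ^ 2 := by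
  have hd : DifferentiableAt ℝ (fderiv ℝ g) z :=
    ((hg.fderiv_right (m := 1) (by norm_num)).differentiable one_ne_zero) z
  have h1 : fderiv ℝ (fun y => fderiv ℝ g y k) z k = fderiv ℝ (fderiv ℝ g) z k k := by
    rw [fderiv_clm_apply hd (differentiableAt_const k)]; simp
  have h2 : iteratedFDeriv ℝ 2 g z ![k, k] = fderiv ℝ (fderiv ℝ g) z k k :=
    iteratedFDeriv_two_apply g z ![k, k]
  rw [h1, ← h2, ← Real.norm_eq_abs]
  calc ‖iteratedFDeriv ℝ 2 g z ![k, k]‖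
      ≤ ‖iteratedFDeriv ℝ 2 g z‖ * ∏ i, ‖(![k, k] : Fin 2 → Space) i‖ :=
        ContinuousMultilinearMap.le_opNorm _ _
    _ = ‖iteratedFDeriv ℝ 2 g z‖ * ‖k‖ ^ 2 := by simp [Fin.prod_univ_two, sq]

end Radial

/-! ### The Puff pair weight profile -/

section Weight

variable {v : ℝ → ℝ≥0∞} {R₀ : ℝ}

/-- All derivatives of `ṽ(y) = v(|y|)` vanish beyond the range: `Dⁿṽ(x) = 0` for `|x| > R₀`
(`ṽ` vanishes on the open set `{|y| > R₀}`). [folklore] -/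
theorem iteratedFDeriv_radial_eq_zero_of_lt (hv : ∀ r, R₀ < r → v r = 0) (n : ℕ) {x : Space}
    (hx : R₀ < ‖x‖) : iteratedFDeriv ℝ n (fun y : Space => (v ‖y‖).toReal) x = 0 := by
  have hsupp : tsupport (fun y : Space => (v ‖y‖).toReal) ⊆ {y : Space | ‖y‖ ≤ R₀} := by
    refine closure_minimal (fun y hy => ?_) (isClosed_le continuous_norm continuous_const)
    by_contra h
    exact hy (by simp [hv _ (lt_of_not_ge h)])
  by_contra h
  have hmem := hsupp (support_iteratedFDeriv_subset n (Function.mem_support.2 h))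
  exact absurd hmem (not_le.2 hx)

/-- The Puff weight profile `W(r) = r²‖D²ṽ(r e₀)‖` (read in `ℝ≥0∞`) vanishes for `r > R₀`.
[folklore] -/
theorem puffWeight_eq_zero_of_lt (hv : ∀ r, R₀ < r → v r = 0) {r : ℝ} (hr : R₀ < r) :
    ENNReal.ofReal (r ^ 2 * ‖iteratedFDeriv ℝ 2 (fun y : Space => (v ‖y‖).toReal)
      (r • EuclideanSpace.single (0 : Fin 3) (1 : ℝ))‖) = 0 := by
  have hn : R₀ < ‖(r • EuclideanSpace.single (0 : Fin 3) (1 : ℝ) : Space)‖ := by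
    rw [norm_smul, Real.norm_eq_abs]
    simpa using hr.trans_le (le_abs_self r)
  rw [iteratedFDeriv_radial_eq_zero_of_lt hv 2 hn, norm_zero, mul_zero, ENNReal.ofReal_zero]

/-- The Puff weight profile is measurable (continuous for `ṽ ∈ C²`). [folklore] -/
theorem measurable_puffWeight (hC : ContDiff ℝ 2 (fun y : Space => (v ‖y‖).toReal)) :
    Measurable (fun r : ℝ => ENNReal.ofReal (r ^ 2 *
      ‖iteratedFDeriv ℝ 2 (fun y : Space => (v ‖y‖).toReal)
        (r • EuclideanSpace.single (0 : Fin 3) (1 : ℝ))‖)) := by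
  refine ENNReal.measurable_ofReal.comp (Continuous.measurable ?_)
  exact (continuous_pow 2).mul ((hC.continuous_iteratedFDeriv le_rfl).comp
    (continuous_id.smul continuous_const)).norm

/-- The real value of the weight profile. [folklore] -/
theorem toReal_puffWeight (v : ℝ → ℝ≥0∞) (r : ℝ) :
    (ENNReal.ofReal (r ^ 2 * ‖iteratedFDeriv ℝ 2 (fun y : Space => (v ‖y‖).toReal)
      (r • EuclideanSpace.single (0 : Fin 3) (1 : ℝ))‖)).toReal =
      r ^ 2 * ‖iteratedFDeriv ℝ 2 (fun y : Space => (v ‖y‖).toReal)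
        (r • EuclideanSpace.single (0 : Fin 3) (1 : ℝ))‖ :=
  ENNReal.toReal_ofReal (by positivity)

end Weight

/-! ### The Hessian of the periodised potential is the Hessian at the nearest image -/

section Hessian

variable {v : ℝ → ℝ≥0∞} {R₀ L : ℝ}

/-- **The Hessian of `v^per` at a point is the Hessian of `ṽ` at the nearest image**: for a
profile of range `R₀` and `2R₀ < L`, every `x₀` admits a lattice point `n₀` with
`v^per(x₀) = v(|x₀ - Ln₀|)` and `∂_{w'}∂_w v^per(x₀) = ∂_{w'}∂_w ṽ(x₀ - Ln₀)` for all directions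
(`v^per` is the translate `ṽ(· - Ln₀)` near `x₀`). [cite: LSSY2005, Ch. 2, remark after (2.2)] -/
theorem exists_fderiv_fderiv_periodizedPotential_eq (hv : ∀ r, R₀ < r → v r = 0)
    (h2R : 2 * R₀ < L) (hL : 0 < L) (x₀ : Space) :
    ∃ n₀ : Fin 3 → ℤ, periodizedPotential v L x₀ = v ‖x₀ - latticeVec L n₀‖ ∧
      ∀ w w' : Space,
        fderiv ℝ (fun x => fderiv ℝ (fun y => (periodizedPotential v L y).toReal) x w) x₀ w' =
          fderiv ℝ (fun x => fderiv ℝ (fun y : Space => (v ‖y‖).toReal) x w)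
            (x₀ - latticeVec L n₀) w' := by
  obtain ⟨n₀, h⟩ := eventually_periodizedPotential_eq_single hv h2R hL x₀
  refine ⟨n₀, h.self_of_nhds, fun w w' => ?_⟩
  set c : Space := latticeVec L n₀ with hc
  set g : Space → ℝ := fun y => (v ‖y‖).toReal with hg
  have h1 : (fun y => (periodizedPotential v L y).toReal) =ᶠ[𝓝 x₀] fun y => g (y - c) :=
    h.mono fun y hy => by simp only [hy, hg]
  have h2 : (fun x => fderiv ℝ (fun y => (periodizedPotential v L y).toReal) x w) =ᶠ[𝓝 x₀]
      fun x => fderiv ℝ (fun y => g (y - c)) x w := by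
    filter_upwards [h1.fderiv (𝕜 := ℝ)] with x hx
    rw [hx]
  rw [h2.fderiv_eq]
  have h3 : (fun x => fderiv ℝ (fun y => g (y - c)) x w) = fun x =>
      (fun z => fderiv ℝ g z w) (x - c) := by
    funext x
    rw [fderiv_comp_sub]
  have h4 : fderiv ℝ (fun x => (fun z => fderiv ℝ g z w) (x - c)) x₀ =
      fderiv ℝ (fun z => fderiv ℝ g z w) (x₀ - c) :=
    fderiv_comp_sub (𝕜 := ℝ) (f := fun z => fderiv ℝ g z w) (x := x₀) c
  rw [h3, h4]

end Hessian

/-! ### The phase factor `|e_m(y) - 1|² ≤ ‖k‖²‖y‖²` -/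

section Phase

variable {L : ℝ}

/-- `|e^{iθ} - 1|² = 2 - 2 cos θ ≤ θ²`. [folklore] -/
theorem norm_exp_mul_I_sub_one_sq_le (θ : ℝ) :
    ‖Complex.exp (θ * Complex.I) - 1‖ ^ 2 ≤ θ ^ 2 := by
  have h : ‖Complex.exp (θ * Complex.I) - 1‖ ^ 2 = 2 - 2 * Real.cos θ := by
    have hre : (Complex.exp (θ * Complex.I)).re = Real.cos θ := Complex.exp_ofReal_mul_I_re θ
    have him : (Complex.exp (θ * Complex.I)).im = Real.sin θ := Complex.exp_ofReal_mul_I_im θ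
    rw [Complex.sq_norm, Complex.normSq_apply]
    simp only [Complex.sub_re, Complex.one_re, Complex.sub_im, Complex.one_im, hre, him]
    nlinarith [Real.sin_sq_add_cos_sq θ]
  rw [h]
  have := Real.one_sub_sq_div_two_le_cos (x := θ)
  linarith

/-- **The phase of a density wave**: `|e_m(y) - 1|² ≤ ‖k‖² ‖y‖²` with `k = 2πm/L`
(`|e^{ik·y} - 1|² = 2 - 2cos(k·y) ≤ (k·y)² ≤ ‖k‖²‖y‖²`). [folklore] -/
theorem norm_cellWave_sub_one_sq_le (L : ℝ) (m : Fin 3 → ℤ) (y : Space) :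
    ‖cellWave L m y - 1‖ ^ 2 ≤ ‖(2 * Real.pi / L) • latticeVec 1 m‖ ^ 2 * ‖y‖ ^ 2 := by
  set k : Space := (2 * Real.pi / L) • latticeVec 1 m with hk
  have hkc : ∀ c, k c = 2 * Real.pi / L * (m c : ℝ) := fun c => by simp [hk, latticeVec]
  set θ : ℝ := ∑ c : Fin 3, k c * y c with hθ
  have hwave : cellWave L m y = Complex.exp (θ * Complex.I) := by
    rw [cellWave_apply]
    congr 1
    rw [hθ]
    push_cast
    rw [Finset.mul_sum, Finset.sum_div, Finset.sum_mul]
    refine Finset.sum_congr rfl fun c _ => ?_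
    rw [hkc c]
    push_cast
    ring
  rw [hwave]
  refine (norm_exp_mul_I_sub_one_sq_le θ).trans ?_
  rw [hθ, EuclideanSpace.real_norm_sq_eq k, EuclideanSpace.real_norm_sq_eq y]
  exact Finset.sum_mul_sq_le_sq_mul_sq Finset.univ (fun c => k c) (fun c => y c)

/-- `e_m` is invariant under lattice translations: `e_m(y + Ln) = e_m(y)` (local copy of
`cellWave_add_latticeVec` of `PeriodicBoseGasLemma33.lean`, not imported here). [folklore] -/
private theorem cellWave_add_latticeVec_aux (hL : L ≠ 0) (m n : Fin 3 → ℤ) (y : Space) :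
    cellWave L m (y + latticeVec L n) = cellWave L m y :=
  periodic_latticeVec (fun x c => cellWave_periodic hL m x c) y n

end Phase

/-! ### The estimate -/

section Estimate

variable {v : ℝ → ℝ≥0∞} {R₀ L : ℝ}

/-- **Puff's pair estimate.** For a finite profile `v` of range `R₀` with `ṽ(y) = v(|y|) ∈ C²`,
`2R₀ < L`, a mode `m` with wave vector `k = 2πm/L`, and every `y ∈ ℝ³`:
`|e_m(y) - 1|² · |∂_k∂_k v^per(y)| ≤ ‖k‖⁴ · W^per(y)`, where `W(r) = r²‖D²ṽ(r e₀)‖` is the Puff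
pair weight and `W^per` its periodisation. (Nearest image `z = y - Ln₀`:
`|e_m(y) - 1|² = |e_m(z) - 1|² ≤ ‖k‖²|z|²`, `|∂_k∂_k v^per(y)| = |D²ṽ(z)(k,k)| ≤ ‖k‖²‖D²ṽ(z)‖ =
‖k‖²‖D²ṽ(|z|e₀)‖`, and `W(|z|) ≤ W^per(y)`.) [cite: Stringari1995, §2.3 (23)] -/
theorem phase_sq_mul_hessian_le_puffWeight (hv : ∀ r, R₀ < r → v r = 0) (h2R : 2 * R₀ < L)
    (hL : 0 < L) (hC : ContDiff ℝ 2 (fun y : Space => (v ‖y‖).toReal)) (m : Fin 3 → ℤ)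
    (y : Space) :
    ‖cellWave L m y - 1‖ ^ 2 *
        |fderiv ℝ (fun x => fderiv ℝ (fun z => (periodizedPotential v L z).toReal) x
          ((2 * Real.pi / L) • latticeVec 1 m)) y ((2 * Real.pi / L) • latticeVec 1 m)| ≤
      ‖(2 * Real.pi / L) • latticeVec 1 m‖ ^ 4 *
        (periodizedPotential (fun r : ℝ => ENNReal.ofReal (r ^ 2 *
          ‖iteratedFDeriv ℝ 2 (fun x : Space => (v ‖x‖).toReal)
            (r • EuclideanSpace.single (0 : Fin 3) (1 : ℝ))‖)) L y).toReal := by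
  obtain ⟨n₀, -, hhess⟩ := exists_fderiv_fderiv_periodizedPotential_eq hv h2R hL y
  set k : Space := (2 * Real.pi / L) • latticeVec 1 m with hk
  set e₀ : Space := EuclideanSpace.single (0 : Fin 3) (1 : ℝ) with he₀
  set g : Space → ℝ := fun x => (v ‖x‖).toReal with hg
  set W : ℝ → ℝ≥0∞ := fun r : ℝ => ENNReal.ofReal (r ^ 2 * ‖iteratedFDeriv ℝ 2 g (r • e₀)‖)
    with hW
  set z : Space := y - latticeVec L n₀ with hz
  -- the phase at the nearest image
  have hphase : ‖cellWave L m y - 1‖ ^ 2 ≤ ‖k‖ ^ 2 * ‖z‖ ^ 2 := by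
    have hy : y = z + latticeVec L n₀ := by rw [hz, sub_add_cancel]
    rw [hy, cellWave_add_latticeVec_aux hL.ne']
    exact norm_cellWave_sub_one_sq_le L m z
  -- the Hessian at the nearest image
  have hrot : ‖iteratedFDeriv ℝ 2 g z‖ = ‖iteratedFDeriv ℝ 2 g (‖z‖ • e₀)‖ :=
    norm_iteratedFDeriv_radial_eq (fun r => (v r).toReal) 2 z
  have hH : |fderiv ℝ (fun x => fderiv ℝ (fun z => (periodizedPotential v L z).toReal) x k) y k|
      ≤ ‖iteratedFDeriv ℝ 2 g (‖z‖ • e₀)‖ * ‖k‖ ^ 2 := by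
    rw [hhess k k, ← hrot]
    exact abs_fderiv_fderiv_apply_le hC z k
  -- the weight at the nearest image is below the periodised weight
  have hWR : ∀ r, R₀ < r → W r = 0 := fun r hr => puffWeight_eq_zero_of_lt hv hr
  have hWy : (W ‖z‖).toReal ≤ (periodizedPotential W L y).toReal := by
    refine ENNReal.toReal_mono (periodizedPotential_ne_top_of_range hWR h2R hL
      (fun r => ENNReal.ofReal_ne_top) y) ?_
    unfold periodizedPotential
    exact ENNReal.le_tsum n₀
  have hWz : (W ‖z‖).toReal = ‖z‖ ^ 2 * ‖iteratedFDeriv ℝ 2 g (‖z‖ • e₀)‖ :=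
    toReal_puffWeight v ‖z‖
  calc ‖cellWave L m y - 1‖ ^ 2 *
        |fderiv ℝ (fun x => fderiv ℝ (fun z => (periodizedPotential v L z).toReal) x k) y k|
      ≤ (‖k‖ ^ 2 * ‖z‖ ^ 2) * (‖iteratedFDeriv ℝ 2 g (‖z‖ • e₀)‖ * ‖k‖ ^ 2) :=
        mul_le_mul hphase hH (abs_nonneg _) (by positivity)
    _ = ‖k‖ ^ 4 * (W ‖z‖).toReal := by rw [hWz]; ring
    _ ≤ ‖k‖ ^ 4 * (periodizedPotential W L y).toReal :=
        mul_le_mul_of_nonneg_left hWy (by positivity)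

end Estimate

end Literature.MathematicalPhysics.QuantumManyBody.BoseGas

end
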